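import Summits.BirchSwinnertonDyer.BirchSwinnertonDyer.Theorems.ByReductionTypeAtTwoSupersingularFlatBlindFirstLayerTwistDetection
import Summits.BirchSwinnertonDyer.BirchSwinnertonDyer.Theorems.ByReductionTypeAtTwoSupersingularFlatBlindLocalTransversality
import HarnessLib

/-!
# Route `ByReductionTypeAtTwo` (rung K4), crux `SupersingularRankZeroAtTwo` (item stmt-BirchSwinnertonDyer-19097):
# **CDF±_H ⟸ ONE KERNEL VALUE MODULO 8** — the Honda rung of slot 5's local conjunct CDF±
# (`OddBlindPackage.FlatBlindLocalTransversalityHondaOffZeroAtTwo`, line `Cruxes/SupersingularRankZeroAtTwo/Lines/odd_blind_package.lean`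
# v2.6.1 18db34093d095bfe :898) reduced in the kernel to (K₈): «some `z ∈ Ker Col♭` has `z(g·c₁) − z(c₁) ≢ 0 (mod 8)`»
# — seat `bsd-2adic-ss-1`, GEN 19, LEAD attack (L3), part 2 (sequel of `…FlatBlindFirstLayerTwistDetection.lean`, p810801)

HONEST FRAMING (cell `bsd-2adic`): THEOREMS ONLY; no definition, no named fact, no `sorry`, no instance.  Nothing booked
(D-0054); BSD is not proved by any of this; (K₈) itself is NOT proved here (it is the residual).  PARTITION: X5@2 good-ss
r₀, `a₂ = ±2` sub-rows × p = 2 — types-the-object-of (CDF±_H's residual becomes ONE mod-8 statement about the joint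
Coleman image at `2`); closes none. bears_on: K4 (item 19097).

## What is proved (generic base `K` in §1–§2; over `ℚ` at `v ∋ 2` in §3)

Notation: `M = E(K_1·K_v)`, `(c₋, c)` a Honda system at two (`F1Sign2.IsHondaSystemAtTwo κ ι W a g c₋ c`), `g` a local lift of
the topological generator, `y₀ = c₁ − s` the explicit ψ₂-generator of p810801 (`g·y₀ = −y₀`, `(g−1)c₁ = −2y₀`), (NT) no
`2`-torsion in `E(K_∞·K_v)`.
* §1 ★ `twistGenerator_mul_apply_eq` — the RANK-ONE IDENTITY on `Y = M^{g=−1}`: for any two additive `ζ, u : M → ℤ₂` and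
  every ψ₂-vector `y`: `ζ(y₀)·u(y) = u(y₀)·ζ(y)` (p810801's dual cyclicity applied to `ζ(y₀)u − u(y₀)ζ`).
* §1 ★ `not_pow_succ_dvd_apply_of_not_eight_dvd` — (Y′), the MOD-8 FORM of (Y): if `z(g·c₁) − z(c₁) ≢ 0 (mod 8)` (i.e.
  `4 ∤ z(y₀)`), then `y ∉ 2^k·M`, `g·y = −y` ⟹ `2^{k+1} ∤ z(y)` — EXACTLY the exponent of the line's index form (separation
  gives `u` with `2^k ∤ u(y)`; the identity gives `z(y₀)u(y) = u(y₀)z(y)`; `v₂(z(y₀)) ≤ 1`).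
* §2 `exists_mem_colemanKer_flat_not_pow_succ_dvd_of_kernelValue` — pointwise: (K₈) for `(W, κ, v, g, c)` ⟹ the conclusion
  of CDF± for every ψ₂-vector; and `kernelValue_of_isColemanPair_X_zero` — (G) ⟹ (K₈) pointwise (a functional with Coleman
  value `(T, 0)` lies in `Ker Col♭` and has `z(g·c₁) − z(c₁) = T(−2) = −2`, p800827).
* §3 ★★ `flatBlindLocalTransversalityHondaOffZeroAtTwo_of_kernelValue` — over `ℚ`: **(K₈) ⟹ CDF±_H**, the conclusion's TYPE being
  VERBATIM the body of the line's rung `OddBlindPackage.FlatBlindLocalTransversalityHondaOffZeroAtTwo` (v2.6.1 :898–925; equal to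
  -imc's copy `D72BlindGenerator.FlatBlindLocalTransversalityHondaOffZeroAtTwo`), so any file importing the line closes the rung
  from (K₈) by `exact`; and ★ `flatBlindLocalTransversalityHondaOffZeroAtTwo_of_generator` — **(G) ⟹ CDF±_H** with (G) in the
  ∀-form of `D72BlindGenerator.HondaBlindGeneratorAtTwo` (D72's ★ with its (Y) hypothesis DISCHARGED by p810801).
So the Honda rung's residual is (K₈) ⟸ (G) ⟸ «`T·Λ₂² ⊆ Col(H¹_Iw)`» (the `p = 2` cokernel statement; at odd `p` the tree's
`Sprung2012.forall_exists_isColemanPair_X_mul_of_independent`, which needs a RANK input the dual generation clauses do not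
supply — the same is true at `2`).  -imc E-26.1: (K₈) ⟺ `Col♯(Ker Col♭_c) ⊄ (8, T+2)`; Honda model: value `−2`.

## References
* [Sprung2012] F. Sprung, J. Number Theory 132 (2012): Thm. 2.2 (p. 1487), Def. 3.1 (p. 1489), Def. 5.9 (p. 1495), Def. 7.9
  (p. 1503), Open Problem 7.22 (p. 1505).
* [Kobayashi2003] S. Kobayashi, Invent. Math. 152 (2003), Prop. 8.12.
* [KuriharaPollack2007] M. Kurihara, R. Pollack, Prop. 1.2 (the joint cokernel, odd `p`, `a_p = 0`).
* Tree: p810801 (`OddBlindLocal.apply_eq_zero_of_apply_twistGenerator_eq_zero`, `exists_twistGenerator_of_isHondaSystemAtTwo`),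
  p800827 (`OddBlindLocal.evalAt_negTwo_sharp_of_isColemanPair_of_mem`), `Cruxes/SupersingularRankZeroAtTwo/D72BlindGenerator.lean`.
-/

set_option autoImplicit false
set_option linter.dupNamespace false

noncomputable section

open scoped Classical NumberField

universe u

namespace Summit.BirchSwinnertonDyer.BirchSwinnertonDyer.Theorems

namespace OddBlindLocal

open NumberField IsDedekindDomain Literature.NumberTheory.EllipticCurves Literature.NumberTheory.GaloisRepresentations
  ZpExtension Literature.NumberTheory.EllipticCurves.Kobayashi2003 Literature.NumberTheory.EllipticCurves.Sprung2017
  Literature.NumberTheory.EllipticCurves.Sprung2012 Literature.NumberTheory.EllipticCurves.Rank1Residual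
  Summit.BirchSwinnertonDyer.Rank1Residual.F1Sign2 Summit.BirchSwinnertonDyer.Rank1Residual.Supersingular.BlindLever

/-! ## §1 Generic base: the rank-one identity and the mod-8 detection -/

section Generic

variable {K : Type u} [Field K] {κ : ZpExtension K 2}
variable {E : Type u} [Field E] [Algebra K E] {ι : AlgebraicClosure K →ₐ[K] AlgebraicClosure E}
variable {W : WeierstrassCurve K}

/-- ★ **RANK-ONE IDENTITY on `E(K_1·K_v)^{g=−1}`.**  For a Honda system at two, `y₀ = c₁ − s` its ψ₂-generator
(`(g−1)c₁ = −2(c₁ − s)`, `s ∈ E(K_v)`), any two additive `ζ, u : E(K_1·K_v) → ℤ₂` and every `y` with `g·y = −y`: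
`ζ(y₀)·u(y) = u(y₀)·ζ(y)` — the functional `ζ(y₀)u − u(y₀)ζ` kills `y₀`, hence all of `E(K_1·K_v)^{g=−1}`
(`apply_eq_zero_of_apply_twistGenerator_eq_zero`). [cite: Sprung2012, Thm. 2.2 (generation clause, p. 1487)]
[cite: Kobayashi2003, Prop. 8.12 (pp. 17–18)] -/
theorem twistGenerator_mul_apply_eq {a : ℤ} {g : Field.absoluteGaloisGroup E}
    (hg : κ.IsTopGenerator (resGalOfEmb ι g)) {cneg : localPoints W E} {c : ℕ → localPoints W E}
    (hH : IsHondaSystemAtTwo κ ι W a g cneg c)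
    {s : localPoints W E} (hs : s ∈ localLayerPointsOfEmb κ ι W 0) (hgen : g • c 1 - c 1 = -(2 • (c 1 - s)))
    (ζ u : localLayerPointsOfEmb κ ι W 1 →+ ℤ_[2])
    {y : localPoints W E} (hy : y ∈ localLayerPointsOfEmb κ ι W 1) (hgy : g • y = -y) :
    ζ ⟨c 1 - s, sub_mem (hH.2.1 1) (localLayerPointsOfEmb_mono κ ι W (Nat.zero_le 1) hs)⟩ * u ⟨y, hy⟩ =
      u ⟨c 1 - s, sub_mem (hH.2.1 1) (localLayerPointsOfEmb_mono κ ι W (Nat.zero_le 1) hs)⟩ * ζ ⟨y, hy⟩ := by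
  have hy₀ : c 1 - s ∈ localLayerPointsOfEmb κ ι W 1 :=
    sub_mem (hH.2.1 1) (localLayerPointsOfEmb_mono κ ι W (Nat.zero_le 1) hs)
  let η : localLayerPointsOfEmb κ ι W 1 →+ ℤ_[2] :=
    (AddMonoidHom.mulLeft (ζ ⟨c 1 - s, hy₀⟩)).comp u - (AddMonoidHom.mulLeft (u ⟨c 1 - s, hy₀⟩)).comp ζ
  have hηapp : ∀ x, η x = ζ ⟨c 1 - s, hy₀⟩ * u x - u ⟨c 1 - s, hy₀⟩ * ζ x := fun x ↦ rfl
  have hη : η ⟨c 1 - s, hy₀⟩ = 0 := by rw [hηapp, mul_comm, sub_self]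
  have h := apply_eq_zero_of_apply_twistGenerator_eq_zero hg hH hs hgen η hη hy hgy
  rwa [hηapp, sub_eq_zero] at h

/-- In `ℤ₂`: if `4 ∤ a` and `2^k ∤ b` then `2^{k+1} ∤ a·b` (`a` carries at most one factor `2`). [folklore] -/
theorem not_pow_succ_dvd_mul_of_not_four_dvd {a b : ℤ_[2]} (ha : ¬ (4 : ℤ_[2]) ∣ a) {k : ℕ}
    (hb : ¬ (2 : ℤ_[2]) ^ k ∣ b) : ¬ (2 : ℤ_[2]) ^ (k + 1) ∣ a * b := by
  have h2 : Prime (2 : ℤ_[2]) := by exact_mod_cast (PadicInt.prime_p (p := 2))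
  intro h
  by_cases h2a : (2 : ℤ_[2]) ∣ a
  · obtain ⟨t, rfl⟩ := h2a
    have ht : ¬ (2 : ℤ_[2]) ∣ t := fun ⟨r, hr⟩ ↦ ha ⟨r, by rw [hr]; ring⟩
    rw [pow_succ', mul_assoc, mul_dvd_mul_iff_left (two_ne_zero : (2 : ℤ_[2]) ≠ 0)] at h
    exact hb (h2.pow_dvd_of_dvd_mul_left k ht h)
  · exact hb (dvd_trans (pow_dvd_pow 2 (Nat.le_succ k)) (h2.pow_dvd_of_dvd_mul_left (k + 1) h2a h))

/-- ★ **(Y′) — MOD-8 FIRST-LAYER DETECTION.**  (NT) no `2`-torsion in the tower; `(c₋, c)` a Honda system at two; `g` a local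
lift of the topological generator; `z : E(K_∞·K_v) → ℤ₂` additive with `z(g·c₁) − z(c₁) ≢ 0 (mod 8)`.  Then `y ∈ E(K_1·K_v)`,
`g·y = −y`, `y ∉ 2^k·E(K_1·K_v)` ⟹ `2^{k+1} ∤ z(y)` — the exponent of the line's index form.  (`z(g·c₁) − z(c₁) = −2z(y₀)`, so
`4 ∤ z(y₀)`; separation `u` with `2^k ∤ u(y)`; rank-one identity `z(y₀)u(y) = u(y₀)z(y)`.)
[cite: Sprung2012, Thm. 2.2 (p. 1487) and Def. 7.9 (p. 1503)] [cite: NeukirchSchmidtWingberg2008, I §1 (1.1.8)] -/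
theorem not_pow_succ_dvd_apply_of_not_eight_dvd
    (hnt : ∀ P ∈ localTowerPointsOfEmb κ ι W, 2 • P = 0 → P = 0)
    {a : ℤ} {g : Field.absoluteGaloisGroup E} (hg : κ.IsTopGenerator (resGalOfEmb ι g))
    {cneg : localPoints W E} {c : ℕ → localPoints W E} (hH : IsHondaSystemAtTwo κ ι W a g cneg c)
    (z : localTowerPointsOfEmb κ ι W →+ ℤ_[2])
    (hz : ¬ (8 : ℤ_[2]) ∣ z ⟨g • c 1, smul_mem_localTowerPointsOfEmb κ ι W g
        (localLayerPointsOfEmb_le_localTowerPointsOfEmb κ ι W 1 (hH.2.1 1))⟩ -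
      z ⟨c 1, localLayerPointsOfEmb_le_localTowerPointsOfEmb κ ι W 1 (hH.2.1 1)⟩)
    {y : localPoints W E} (hy : y ∈ localLayerPointsOfEmb κ ι W 1) (hgy : g • y = -y)
    {k : ℕ} (hndiv : ∀ w ∈ localLayerPointsOfEmb κ ι W 1, 2 ^ k • w ≠ y) :
    ¬ (2 : ℤ_[2]) ^ (k + 1) ∣ z ⟨y, localLayerPointsOfEmb_le_localTowerPointsOfEmb κ ι W 1 hy⟩ := by
  have hle : localLayerPointsOfEmb κ ι W 1 ≤ localTowerPointsOfEmb κ ι W :=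
    localLayerPointsOfEmb_le_localTowerPointsOfEmb κ ι W 1
  have hc1 : c 1 ∈ localLayerPointsOfEmb κ ι W 1 := hH.2.1 1
  obtain ⟨s, hs, -, hgen⟩ := exists_twistGenerator_of_isHondaSystemAtTwo hg hH
  have hy₀ : c 1 - s ∈ localLayerPointsOfEmb κ ι W 1 :=
    sub_mem hc1 (localLayerPointsOfEmb_mono κ ι W (Nat.zero_le 1) hs)
  let ζ : localLayerPointsOfEmb κ ι W 1 →+ ℤ_[2] := z.comp (AddSubgroup.inclusion hle)
  have hζ : ∀ (x : localPoints W E) (hx : x ∈ localLayerPointsOfEmb κ ι W 1), ζ ⟨x, hx⟩ = z ⟨x, hle hx⟩ :=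
    fun x hx ↦ rfl
  -- `z(g•c₁) − z(c₁) = −2·z(y₀)`, so `4 ∤ z(y₀)`
  have hval : z ⟨g • c 1, smul_mem_localTowerPointsOfEmb κ ι W g (hle hc1)⟩ - z ⟨c 1, hle hc1⟩ =
      -(2 * ζ ⟨c 1 - s, hy₀⟩) := by
    have e : (⟨g • c 1, smul_mem_localTowerPointsOfEmb κ ι W g (hle hc1)⟩ : localTowerPointsOfEmb κ ι W) -
        ⟨c 1, hle hc1⟩ = -(2 • ⟨c 1 - s, hle hy₀⟩) := by
      apply Subtype.ext
      change g • c 1 - c 1 = -(2 • (c 1 - s))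
      exact hgen
    rw [← map_sub, e, map_neg, map_nsmul, nsmul_eq_mul, Nat.cast_ofNat, hζ]
  have h4 : ¬ (4 : ℤ_[2]) ∣ ζ ⟨c 1 - s, hy₀⟩ := by
    rintro ⟨t, ht⟩
    apply hz
    rw [hval, ht]
    exact ⟨-t, by ring⟩
  -- separation on the layer
  have hM2 : ∀ q : localLayerPointsOfEmb κ ι W 1, 2 • q = 0 → q = 0 := fun q hq ↦
    Subtype.ext (hnt q (hle q.2) (by rw [← AddSubgroupClass.coe_nsmul, hq, AddSubgroup.coe_zero]))
  have hndivM : ∀ q : localLayerPointsOfEmb κ ι W 1, 2 ^ k • q ≠ ⟨y, hy⟩ := fun q hq ↦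
    hndiv q q.2 (by rw [← AddSubgroupClass.coe_nsmul, hq])
  obtain ⟨u, hu⟩ := Literature.Algebra.Module.exists_addMonoidHom_padicInt_not_dvd (p := 2) hM2 hndivM
  have hu' : ¬ (2 : ℤ_[2]) ^ k ∣ u ⟨y, hy⟩ := by exact_mod_cast hu
  -- rank-one identity and the valuation count
  have hid := twistGenerator_mul_apply_eq hg hH hs hgen ζ u hy hgy
  intro hdvd
  rw [hζ y hy] at hid
  exact not_pow_succ_dvd_mul_of_not_four_dvd h4 hu' (by rw [hid]; exact Dvd.dvd.mul_left hdvd _)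

end Generic

/-! ## §2 Pointwise: (K₈) ⟹ CDF±'s conclusion; (G) ⟹ (K₈) -/

section Pointwise

variable {K : Type u} [Field K] {κ : ZpExtension K 2}
variable {E : Type u} [Field E] [Algebra K E] {ι : AlgebraicClosure K →ₐ[K] AlgebraicClosure E}
variable {W : WeierstrassCurve K}

/-- **(K₈) ⟹ the conclusion of CDF± for every ψ₂-vector** (pointwise, generic base): if some `z ∈ Ker Col♭` of a Honda
system at two has `z(g·c₁) − z(c₁) ≢ 0 (mod 8)`, then for every `y ∈ E(K_1·K_v)` with `g·y = −y`, `y ∉ 2^k·E(K_1·K_v)`,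
some `z ∈ Ker Col♭` (the same one) has `2^{k+1} ∤ z(y)`. [cite: Sprung2012, Def. 7.9 (p. 1503)] -/
theorem exists_mem_colemanKer_flat_not_pow_succ_dvd_of_kernelValue
    (hnt : ∀ P ∈ localTowerPointsOfEmb κ ι W, 2 • P = 0 → P = 0)
    {a : ℤ} {g : Field.absoluteGaloisGroup E} (hg : κ.IsTopGenerator (resGalOfEmb ι g))
    {cneg : localPoints W E} {c : ℕ → localPoints W E} (hH : IsHondaSystemAtTwo κ ι W a g cneg c)
    (hK : ∃ z ∈ colemanKer κ ι W a g c .flat,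
      ¬ (8 : ℤ_[2]) ∣ z ⟨g • c 1, smul_mem_localTowerPointsOfEmb κ ι W g
          (localLayerPointsOfEmb_le_localTowerPointsOfEmb κ ι W 1 (hH.2.1 1))⟩ -
        z ⟨c 1, localLayerPointsOfEmb_le_localTowerPointsOfEmb κ ι W 1 (hH.2.1 1)⟩)
    {y : localPoints W E} (hy : y ∈ localLayerPointsOfEmb κ ι W 1) (hgy : g • y = -y)
    {k : ℕ} (hndiv : ∀ w ∈ localLayerPointsOfEmb κ ι W 1, 2 ^ k • w ≠ y) :
    ∃ z ∈ colemanKer κ ι W a g c .flat,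
      ¬ (2 : ℤ_[2]) ^ (k + 1) ∣ z ⟨y, localLayerPointsOfEmb_le_localTowerPointsOfEmb κ ι W 1 hy⟩ := by
  obtain ⟨z, hzK, hz⟩ := hK
  exact ⟨z, hzK, not_pow_succ_dvd_apply_of_not_eight_dvd hnt hg hH z hz hy hgy hndiv⟩

/-- **(G) ⟹ (K₈), pointwise**: a functional with Coleman value `(T, 0)` lies in `Ker Col♭` and has
`z(g·c₁) − z(c₁) = T(−2) = −2 ≢ 0 (mod 8)` (p800827's level-one identity `Col♯(z)(−2) = z(g·c₁) − z(c₁)`).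
[cite: Sprung2012, Def. 5.9 (p. 1495) and Def. 7.9 (p. 1503)] -/
theorem kernelValue_of_isColemanPair_X_zero {a : ℤ} {g : Field.absoluteGaloisGroup E}
    {c : ℕ → localPoints W E} (hc1 : c 1 ∈ localTowerPointsOfEmb κ ι W)
    {z : localTowerPointsOfEmb κ ι W →+ ℤ_[2]} (hz : IsColemanPair κ ι W a g c z PowerSeries.X 0) :
    z ∈ colemanKer κ ι W a g c .flat ∧
      z ⟨g • c 1, smul_mem_localTowerPointsOfEmb κ ι W g hc1⟩ - z ⟨c 1, hc1⟩ = -2 := by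
  have hid := evalAt_negTwo_sharp_of_isColemanPair_of_mem hc1 hz
  rw [evalAt_X] at hid
  exact ⟨⟨PowerSeries.X, 0, hz, rfl⟩, hid.symm⟩

/-- `−2 ≢ 0 (mod 8)` in `ℤ₂`. [folklore] -/
theorem not_eight_dvd_neg_two : ¬ (8 : ℤ_[2]) ∣ (-2 : ℤ_[2]) := by
  rintro ⟨t, ht⟩
  have h2 : Prime (2 : ℤ_[2]) := by exact_mod_cast (PadicInt.prime_p (p := 2))
  have h : (2 : ℤ_[2]) * (-1) = 2 * (4 * t) := by linear_combination ht
  have h' : (-1 : ℤ_[2]) = 4 * t := mul_left_cancel₀ two_ne_zero h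
  have hdvd : (2 : ℤ_[2]) ∣ -1 := ⟨2 * t, by rw [h']; ring⟩
  exact h2.not_unit (isUnit_of_dvd_unit hdvd isUnit_one.neg)

end Pointwise

/-! ## §3 Over `ℚ` at `v ∋ 2`: (K₈) ⟹ CDF±_H and (G) ⟹ CDF±_H, with the rung's body VERBATIM -/

section Rat

/-- ★★ **(K₈) ⟹ CDF±_H.**  The conclusion is, VERBATIM, the body of the line's rung
`OddBlindPackage.FlatBlindLocalTransversalityHondaOffZeroAtTwo` (`Lines/odd_blind_package.lean` v2.6.1 :898–925, = -imc's copy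
`D72BlindGenerator.FlatBlindLocalTransversalityHondaOffZeroAtTwo`): for `W/ℚ` globally minimal, non-CM (unused), `GoodSS W 2`,
`a₂ ≠ 0` (unused), odd root-number sign (unused), `κ` cyclotomic with `γ` (unused), `v ∋ 2`, `g`, `c` with (L)(TR)(Z)(SAT) (only (L)
used) and a Honda system at two `(c₋, c)`: local transversality of the ♭ condition at `ψ₂` in the INDEX form.  The hypothesis (K₈):
for all such data, SOME `z ∈ Ker Col♭_c` has `z(g·c₁) − z(c₁) ≢ 0 (mod 8)` (-imc E-26.1: ⟺ `Col♯(Ker Col♭_c) ⊄ (8, T+2)`; Honda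
model: the value is `−2`).  [cite: Sprung2012, Def. 7.9 (p. 1503), Open Problem 7.22 (p. 1505)] -/
theorem flatBlindLocalTransversalityHondaOffZeroAtTwo_of_kernelValue
    (hK : ∀ (W : WeierstrassCurve ℚ) [W.IsElliptic] [W.IsGloballyMinimal],
      GoodSS W 2 → W.frobeniusTrace 2 ≠ 0 →
      ∀ (κ : ZpExtension ℚ 2), κ.IsCyclotomic →
      ∀ (v : HeightOneSpectrum (𝓞 ℚ)), (2 : 𝓞 ℚ) ∈ v.asIdeal →
      ∀ (g : Field.absoluteGaloisGroup (v.adicCompletion ℚ)) (c : ℕ → localPoints W (v.adicCompletion ℚ)),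
        κ.IsTopGenerator (resGalOfEmb (closureEmb (K := ℚ) (v.adicCompletion ℚ)) g) →
        ∀ (hc : ∀ n, c n ∈ localLayerPointsOfEmb κ (closureEmb (K := ℚ) (v.adicCompletion ℚ)) W n),
        (∃ cneg : localPoints W (v.adicCompletion ℚ),
          Summit.BirchSwinnertonDyer.Rank1Residual.F1Sign2.IsHondaSystemAtTwo κ (closureEmb (K := ℚ) (v.adicCompletion ℚ)) W
            (W.frobeniusTrace 2) g cneg c) →
        ∃ z ∈ colemanKer κ (closureEmb (K := ℚ) (v.adicCompletion ℚ)) W (W.frobeniusTrace 2) g c .flat,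
          ¬ (8 : ℤ_[2]) ∣
            z ⟨g • c 1, smul_mem_localTowerPointsOfEmb κ (closureEmb (K := ℚ) (v.adicCompletion ℚ)) W g
                (localLayerPointsOfEmb_le_localTowerPointsOfEmb κ (closureEmb (K := ℚ) (v.adicCompletion ℚ)) W 1 (hc 1))⟩
              - z ⟨c 1, localLayerPointsOfEmb_le_localTowerPointsOfEmb κ (closureEmb (K := ℚ) (v.adicCompletion ℚ)) W 1 (hc 1)⟩) :
    ∀ (W : WeierstrassCurve ℚ) [W.IsElliptic] [W.IsGloballyMinimal],
    ¬ W.HasCM → GoodSS W 2 → W.frobeniusTrace 2 ≠ 0 → W.rootNumber * ZMod.χ₈ (W.conductorNorm ℤ : ZMod 8) = -1 →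
    ∀ (κ : ZpExtension ℚ 2) (γ : Field.absoluteGaloisGroup ℚ),
      κ.IsCyclotomic → κ.IsTopGenerator γ → IsCyclotomicVariable 2 γ →
    ∀ (v : HeightOneSpectrum (𝓞 ℚ)), (2 : 𝓞 ℚ) ∈ v.asIdeal →
    ∀ (g : Field.absoluteGaloisGroup (v.adicCompletion ℚ)) (c : ℕ → localPoints W (v.adicCompletion ℚ)),
      κ.IsTopGenerator (resGalOfEmb (closureEmb (K := ℚ) (v.adicCompletion ℚ)) g) →
      (∀ n, c n ∈ localLayerPointsOfEmb κ (closureEmb (K := ℚ) (v.adicCompletion ℚ)) W n) →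
      (∀ n, 1 ≤ n → localTraceOfEmb κ (closureEmb (K := ℚ) (v.adicCompletion ℚ)) W n (n + 1)
        (c (n + 1)) = W.frobeniusTrace 2 • c n - c (n - 1)) →
      (∀ z₀ : localLayerPointsOfEmb κ (closureEmb (K := ℚ) (v.adicCompletion ℚ)) W 0 →+ ℤ_[2],
        evalOn W (localLayerPointsOfEmb κ (closureEmb (K := ℚ) (v.adicCompletion ℚ)) W 0) z₀ (c 0) = 0 →
          z₀ = 0) →
      (∀ a : ℤ_[2],
        (∃ z₀ : localLayerPointsOfEmb κ (closureEmb (K := ℚ) (v.adicCompletion ℚ)) W 0 →+ ℤ_[2],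
          evalOn W (localLayerPointsOfEmb κ (closureEmb (K := ℚ) (v.adicCompletion ℚ)) W 0) z₀ (c 0) = 2 * a) →
        ∃ y : localLayerPointsOfEmb κ (closureEmb (K := ℚ) (v.adicCompletion ℚ)) W 0 →+ ℤ_[2],
          evalOn W (localLayerPointsOfEmb κ (closureEmb (K := ℚ) (v.adicCompletion ℚ)) W 0) y (c 0) = a) →
      (∃ cneg : localPoints W (v.adicCompletion ℚ),
        Summit.BirchSwinnertonDyer.Rank1Residual.F1Sign2.IsHondaSystemAtTwo κ (closureEmb (K := ℚ) (v.adicCompletion ℚ)) W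
          (W.frobeniusTrace 2) g cneg c) →
      ∀ (y : localPoints W (v.adicCompletion ℚ))
        (hy : y ∈ localLayerPointsOfEmb κ (closureEmb (K := ℚ) (v.adicCompletion ℚ)) W 1), g • y = -y →
        ∀ k : ℕ, (∀ w ∈ localLayerPointsOfEmb κ (closureEmb (K := ℚ) (v.adicCompletion ℚ)) W 1, 2 ^ k • w ≠ y) →
          ∃ z ∈ colemanKer κ (closureEmb (K := ℚ) (v.adicCompletion ℚ)) W (W.frobeniusTrace 2) g c .flat,
            ¬ (2 : ℤ_[2]) ^ (k + 1) ∣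
              z ⟨y, localLayerPointsOfEmb_le_localTowerPointsOfEmb κ (closureEmb (K := ℚ) (v.adicCompletion ℚ)) W 1 hy⟩ := by
  intro W _ _ _hCM hss ha _hodd κ _γ hκ _hγ _hcv v hv g c hg hc _htr _hz _hsat hH y hy hgy k hnd
  obtain ⟨z, hzK, hz⟩ := hK W hss ha κ hκ v hv g c hg hc hH
  obtain ⟨cneg, hH⟩ := hH
  exact ⟨z, hzK, not_pow_succ_dvd_apply_of_not_eight_dvd
    (SignedKatoOffTwo.SignedIntersection.noTwoTorsion_localTowerPointsOfEmb_adicCompletion W hss κ v hv _)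
    hg hH z hz hy hgy hnd⟩

/-- ★ **(G) ⟹ CDF±_H** — -imc's `D72BlindGenerator.flatBlindLocalTransversalityHondaOffZeroAtTwo_of_generator` with its (Y)
hypothesis DISCHARGED (p810801): the hypothesis is the ∀-form body of `D72BlindGenerator.HondaBlindGeneratorAtTwo` (a functional
with Coleman value `(T, 0)` for every Honda system at two, `a₂ ≠ 0`), the conclusion the body of the line's rung CDF±_H, both
VERBATIM. [cite: Sprung2012, Def. 5.9 (p. 1495), Def. 7.9 (p. 1503), Open Problem 7.22 (p. 1505)] -/
theorem flatBlindLocalTransversalityHondaOffZeroAtTwo_of_generator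
    (hG : ∀ (W : WeierstrassCurve ℚ) [W.IsElliptic] [W.IsGloballyMinimal],
      GoodSS W 2 → W.frobeniusTrace 2 ≠ 0 →
      ∀ (κ : ZpExtension ℚ 2), κ.IsCyclotomic →
      ∀ (v : HeightOneSpectrum (𝓞 ℚ)), (2 : 𝓞 ℚ) ∈ v.asIdeal →
      ∀ (g : Field.absoluteGaloisGroup (v.adicCompletion ℚ)) (c : ℕ → localPoints W (v.adicCompletion ℚ)),
        κ.IsTopGenerator (resGalOfEmb (closureEmb (K := ℚ) (v.adicCompletion ℚ)) g) →
        (∀ n, c n ∈ localLayerPointsOfEmb κ (closureEmb (K := ℚ) (v.adicCompletion ℚ)) W n) →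
        (∃ cneg : localPoints W (v.adicCompletion ℚ),
          Summit.BirchSwinnertonDyer.Rank1Residual.F1Sign2.IsHondaSystemAtTwo κ (closureEmb (K := ℚ) (v.adicCompletion ℚ)) W
            (W.frobeniusTrace 2) g cneg c) →
        ∃ z : localTowerPointsOfEmb κ (closureEmb (K := ℚ) (v.adicCompletion ℚ)) W →+ ℤ_[2],
          IsColemanPair κ (closureEmb (K := ℚ) (v.adicCompletion ℚ)) W (W.frobeniusTrace 2) g c z PowerSeries.X 0) :
    ∀ (W : WeierstrassCurve ℚ) [W.IsElliptic] [W.IsGloballyMinimal],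
    ¬ W.HasCM → GoodSS W 2 → W.frobeniusTrace 2 ≠ 0 → W.rootNumber * ZMod.χ₈ (W.conductorNorm ℤ : ZMod 8) = -1 →
    ∀ (κ : ZpExtension ℚ 2) (γ : Field.absoluteGaloisGroup ℚ),
      κ.IsCyclotomic → κ.IsTopGenerator γ → IsCyclotomicVariable 2 γ →
    ∀ (v : HeightOneSpectrum (𝓞 ℚ)), (2 : 𝓞 ℚ) ∈ v.asIdeal →
    ∀ (g : Field.absoluteGaloisGroup (v.adicCompletion ℚ)) (c : ℕ → localPoints W (v.adicCompletion ℚ)),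
      κ.IsTopGenerator (resGalOfEmb (closureEmb (K := ℚ) (v.adicCompletion ℚ)) g) →
      (∀ n, c n ∈ localLayerPointsOfEmb κ (closureEmb (K := ℚ) (v.adicCompletion ℚ)) W n) →
      (∀ n, 1 ≤ n → localTraceOfEmb κ (closureEmb (K := ℚ) (v.adicCompletion ℚ)) W n (n + 1)
        (c (n + 1)) = W.frobeniusTrace 2 • c n - c (n - 1)) →
      (∀ z₀ : localLayerPointsOfEmb κ (closureEmb (K := ℚ) (v.adicCompletion ℚ)) W 0 →+ ℤ_[2],
        evalOn W (localLayerPointsOfEmb κ (closureEmb (K := ℚ) (v.adicCompletion ℚ)) W 0) z₀ (c 0) = 0 →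
          z₀ = 0) →
      (∀ a : ℤ_[2],
        (∃ z₀ : localLayerPointsOfEmb κ (closureEmb (K := ℚ) (v.adicCompletion ℚ)) W 0 →+ ℤ_[2],
          evalOn W (localLayerPointsOfEmb κ (closureEmb (K := ℚ) (v.adicCompletion ℚ)) W 0) z₀ (c 0) = 2 * a) →
        ∃ y : localLayerPointsOfEmb κ (closureEmb (K := ℚ) (v.adicCompletion ℚ)) W 0 →+ ℤ_[2],
          evalOn W (localLayerPointsOfEmb κ (closureEmb (K := ℚ) (v.adicCompletion ℚ)) W 0) y (c 0) = a) →
      (∃ cneg : localPoints W (v.adicCompletion ℚ),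
        Summit.BirchSwinnertonDyer.Rank1Residual.F1Sign2.IsHondaSystemAtTwo κ (closureEmb (K := ℚ) (v.adicCompletion ℚ)) W
          (W.frobeniusTrace 2) g cneg c) →
      ∀ (y : localPoints W (v.adicCompletion ℚ))
        (hy : y ∈ localLayerPointsOfEmb κ (closureEmb (K := ℚ) (v.adicCompletion ℚ)) W 1), g • y = -y →
        ∀ k : ℕ, (∀ w ∈ localLayerPointsOfEmb κ (closureEmb (K := ℚ) (v.adicCompletion ℚ)) W 1, 2 ^ k • w ≠ y) →
          ∃ z ∈ colemanKer κ (closureEmb (K := ℚ) (v.adicCompletion ℚ)) W (W.frobeniusTrace 2) g c .flat,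
            ¬ (2 : ℤ_[2]) ^ (k + 1) ∣
              z ⟨y, localLayerPointsOfEmb_le_localTowerPointsOfEmb κ (closureEmb (K := ℚ) (v.adicCompletion ℚ)) W 1 hy⟩ := by
  refine flatBlindLocalTransversalityHondaOffZeroAtTwo_of_kernelValue fun W _ _ hss ha κ hκ v hv g c hg hc hH ↦ ?_
  obtain ⟨z, hz⟩ := hG W hss ha κ hκ v hv g c hg hc hH
  have hc1 := localLayerPointsOfEmb_le_localTowerPointsOfEmb κ (closureEmb (K := ℚ) (v.adicCompletion ℚ)) W 1 (hc 1)
  obtain ⟨hzK, hval⟩ := kernelValue_of_isColemanPair_X_zero hc1 hz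
  exact ⟨z, hzK, by rw [hval]; exact not_eight_dvd_neg_two⟩

end Rat

end OddBlindLocal

end Summit.BirchSwinnertonDyer.BirchSwinnertonDyer.Theorems

end
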